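import Mathlib.Data.Real.Basic
import Mathlib.Tactic.Linarith
import Mathlib.Tactic.Ring
import HarnessLib

/-!
# `NoHeavyLowerTail` (stmt-CriticalPhenomena-4575) — three-point lower bound `3PT-LB = SHK3⁺` by four switchings, III:
# the finite certificate check and the cubic identity

Support file (prover prim-cert-2; `--supports stmt-CriticalPhenomena-4575`).  No named facts, no sorries; graph-free.

The two finite ingredients of prim-lit-2's proof of `3PT-LB` (PROOF-3PTLB.md, 2026-08-19) that do not mention
graphs:
* `certB_nonpos` / `certP_nonpos` — **Lemma 2 (pointwise), abstract form.**  After the cluster facts F1–F4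
  (file `…ThreePointLBSwitchingClusters`) rewrite every cell-membership of the outputs of the four switchings,
  the pointwise sum of potentials `S = λ₀ + λ₁∘Φ₁ + λ₂∘Φ₂ + λ₃∘Φ₃ + λ₄∘Φ₄` is a fixed signed sum of nine
  indicator monomials in FIFTEEN atomic connection statements
  (`xab, xac, xbc` for copy `X`; `yab, yac, ybc` for `Y`; `zac` for `Z`; `zB = [a ~ c by Z-pairs avoiding B]`,
  `yA = [b ~ c by Y-pairs avoiding A]`; `m1, m2` the surviving connections of F3; `s3a, s3b, s4a, s4b` the
  connections of `c` in the two-region outputs), and F3/F4 + transitivity supply twelve implications between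
  the atoms.  `certB_nonpos`: on all `2¹⁵` Boolean patterns satisfying the implications the sum is `≤ 0`
  (`decide`); `certP_nonpos`: the same for arbitrary propositions, with the instance-free indicator `pind`.
* `cert_identity` — **IDENTITY (E)**: with `q + u_a + u_b + u_c + t = 1`, the sum of the nine expectations
  `E[λ_i]` (products of cell probabilities) equals `−F = −((1+t)(qt − e₂(u)) − e₃(u))` (`ring`).
-/

noncomputable section

namespace Summit.CriticalPhenomena.PercolationContinuityZ3.Theorems

namespace ThreePointLB

/-! ### Instance-free indicator of a proposition -/

open Classical in
/-- `pind P = 1` if `P` holds, else `0` (classical). [folklore] -/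
def pind (P : Prop) : ℝ := if P then 1 else 0


/-! ### The finite certificate check: the potentials sum to `≤ 0` on every pattern of the 15 atoms -/

/-- `0/1`-value of a Boolean, as an integer. [folklore] -/
def bI (b : Bool) : ℤ := if b = true then 1 else 0

/-- The pointwise certificate as a function of the 15 Boolean atoms (see `cert_nonpos`). [folklore] -/
def certB (xab xac xbc yab yac ybc zac zB yA m1 m2 s3a s3b s4a s4b : Bool) : ℤ :=
  - bI (!xab && (!xac && !xbc))
  - bI ((!xab && (!xac && !xbc)) && ((ybc && !yab) && zac))
  + bI ((!xab && (!xac && !xbc)) && ((yab && yac) && !zac))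
  + bI ((xac && !xab) && ((yab && yac) && !zac))
  + bI (!m1 && ((((xab && xac) || (!xab && yA)) && !xab) && zac))
  + bI (!m2 && ((ybc && !yab) && (((xab && xbc) || (!xab && zB)) && !xab)))
  - bI ((yab && yac) && (!xab && (!((xab && xbc) || (!xab && zB)) && !xbc)))
  + bI ((((xab && xac) || (!xab && yA)) && !xab) && (!s3a && !s3b))
  + bI ((!s4a && !s4b) && (!xab && !xbc))

set_option synthInstance.maxHeartbeats 200000 in
set_option synthInstance.maxSize 2048 in
/-- **The certificate is pointwise nonpositive** on every Boolean pattern of the atoms compatible with the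
twelve implications supplied by the cluster facts F1–F4 (`2¹⁵` cases, by `decide`). [folklore] -/
theorem certB_nonpos : ∀ xab xac xbc yab yac ybc zac zB yA m1 m2 s3a s3b s4a s4b : Bool,
    (xac = true → xbc = true → xab = true) → (yab = true → ybc = true → yac = true) →
    (zB = true → zac = true) → (yA = true → ybc = true) →
    (xab = false → xbc = true → zB = false) → (xab = false → xac = true → yA = false) →
    (xab = false → xbc = true → m1 = true) → (xab = false → xac = true → m2 = true) →
    (zB = true → s3a = true) → (xab = false → xbc = true → s3b = true) →
    (yA = true → s4b = true) → (xab = false → xac = true → s4a = true) →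
    certB xab xac xbc yab yac ybc zac zB yA m1 m2 s3a s3b s4a s4b ≤ 0 := by
  decide +kernel

/-- `pind` through `bI ∘ decide`. [folklore] -/
theorem pind_eq_bI (P : Prop) [d : Decidable P] : pind P = (bI (@decide P d) : ℝ) := by
  by_cases hP : P
  · simp [pind, bI, hP]
  · simp [pind, bI, hP]

/-- **Pointwise lemma, propositional form** (PROOF-3PTLB.md, Lemma 2 with the cluster facts abstracted): for
any fifteen propositions satisfying the twelve implications, the certificate expression is `≤ 0`. [folklore] -/
theorem certP_nonpos (xab xac xbc yab yac ybc zac zB yA m1 m2 s3a s3b s4a s4b : Prop)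
    (h1 : xac → xbc → xab) (h2 : yab → ybc → yac) (h3 : zB → zac) (h4 : yA → ybc)
    (h5 : ¬xab → xbc → ¬zB) (h6 : ¬xab → xac → ¬yA) (h7 : ¬xab → xbc → m1) (h8 : ¬xab → xac → m2)
    (h9 : zB → s3a) (h10 : ¬xab → xbc → s3b) (h11 : yA → s4b) (h12 : ¬xab → xac → s4a) :
    -pind (¬xab ∧ ¬xac ∧ ¬xbc)
    - pind ((¬xab ∧ ¬xac ∧ ¬xbc) ∧ (ybc ∧ ¬yab) ∧ zac)
    + pind ((¬xab ∧ ¬xac ∧ ¬xbc) ∧ (yab ∧ yac) ∧ ¬zac)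
    + pind ((xac ∧ ¬xab) ∧ (yab ∧ yac) ∧ ¬zac)
    + pind (¬m1 ∧ ((xab ∧ xac ∨ ¬xab ∧ yA) ∧ ¬xab) ∧ zac)
    + pind (¬m2 ∧ (ybc ∧ ¬yab) ∧ (xab ∧ xbc ∨ ¬xab ∧ zB) ∧ ¬xab)
    - pind ((yab ∧ yac) ∧ ¬xab ∧ ¬(xab ∧ xbc ∨ ¬xab ∧ zB) ∧ ¬xbc)
    + pind (((xab ∧ xac ∨ ¬xab ∧ yA) ∧ ¬xab) ∧ ¬s3a ∧ ¬s3b)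
    + pind ((¬s4a ∧ ¬s4b) ∧ ¬xab ∧ ¬xbc) ≤ 0 := by
  classical
  have key := certB_nonpos (decide xab) (decide xac) (decide xbc) (decide yab) (decide yac) (decide ybc)
      (decide zac) (decide zB) (decide yA) (decide m1) (decide m2) (decide s3a) (decide s3b) (decide s4a)
      (decide s4b)
      (by simpa only [decide_eq_true_eq] using h1) (by simpa only [decide_eq_true_eq] using h2)
      (by simpa only [decide_eq_true_eq] using h3) (by simpa only [decide_eq_true_eq] using h4)
      (by simpa only [decide_eq_true_eq, decide_eq_false_iff_not] using h5)
      (by simpa only [decide_eq_true_eq, decide_eq_false_iff_not] using h6)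
      (by simpa only [decide_eq_true_eq, decide_eq_false_iff_not] using h7)
      (by simpa only [decide_eq_true_eq, decide_eq_false_iff_not] using h8)
      (by simpa only [decide_eq_true_eq] using h9)
      (by simpa only [decide_eq_true_eq, decide_eq_false_iff_not] using h10)
      (by simpa only [decide_eq_true_eq] using h11)
      (by simpa only [decide_eq_true_eq, decide_eq_false_iff_not] using h12)
  rw [pind_eq_bI, pind_eq_bI, pind_eq_bI, pind_eq_bI, pind_eq_bI, pind_eq_bI, pind_eq_bI, pind_eq_bI,
    pind_eq_bI]
  simp only [Bool.decide_and, Bool.decide_or, decide_not]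
  unfold certB at key
  exact_mod_cast key

/-! ### The cubic identity -/

/-- The cubic identity `Σ_i E[λ_i] = −F` (PROOF-3PTLB.md, IDENTITY (E)), as a polynomial identity in the
five cell probabilities with `q + u_a + u_b + u_c + t = 1`. [folklore] -/
theorem cert_identity (q ua ub uc t : ℝ) (h : q + ua + ub + uc + t = 1) :
    -(q * 1 * 1) - q * ua * (ub + t) + q * t * (q + ua + uc) + ub * t * (q + ua + uc)
      + (q + ub + uc) * ua * (ub + t) + (q + ua + uc) * ua * ub - 1 * t * q + 1 * ua * (q + uc)
      + 1 * (q + uc) * (q + ub) =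
    -((1 + t) * (q * t - (uc * ub + uc * ua + ub * ua)) - uc * ub * ua) := by
  have hq : q = 1 - ua - ub - uc - t := by linarith
  subst hq
  ring

end ThreePointLB

end Summit.CriticalPhenomena.PercolationContinuityZ3.Theorems

end
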